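/-
Copyright: H21 programme, solo seat `solo-RiemannHypothesis-informed` (session 5).
-/
import Summits.RiemannHypothesis.RiemannHypothesis.Theorems.SoloInformedClusterFar

/-!
# The maximal-offset cluster window (solo-informed, T29)

Window, parameter-free and exclusion forms of T28
(`weilGroundEnergy_neg_of_maxOffset_cluster_eff`).  Choosing the near-zone radius
`Δ₀ ≥ e^{η(c+1)}` makes the far surcharge `1 + e^{2η(c+1)}/Δ₀²` at most `2`, so the T26 window
arithmetic applies with the cluster constant doubled:

* `clusterFarC0 ψ N R₀ δ η` — the definite offset `c₀` (T26's with `K_N ↦ 2K_N`);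
* `weilGroundEnergy_neg_of_maxOffset_cluster_window_eff` (**T29**): `|γ₀| ≥ 1`,
  `c ≥ c₀ + log log(|γ₀|+2)/(2η)`, `e^{c+1} ≤ R²`, `e^{η(c+1)} ≤ Δ₀`, `ζ(½ + η + iγ₀) = 0`, every
  off-line zero of the window `|Im ρ − γ₀| < R` at height distance `≥ Δ₀` has offset `≤ η`, and
  those at distance `< Δ₀` other than the pair form a cluster (`≤ N` members, radius `R₀`,
  separation `δ`) ⟹ `ε(c + 1) < 0`;
* `weilGroundEnergy_neg_of_maxOffset_cluster_offset_eff` (**T29′**, `ψ₁ = windowPlateau 1`, either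
  sign of `η`) and the exclusion form
  `riemannZeta_ne_zero_of_maxOffset_cluster_of_weilGroundEnergy_nonneg_eff` (**T29″**).

Since `a = c + 1 ≍ (2η)⁻¹ log log γ₀ + C`, the near zone has radius
`e^{η(c+1)} ≍ C(η) (log γ₀)^{1/2}` — far inside the polylog window `R ≍ (log γ₀)^{1/(4η)}` — and
this is the sharpest typed wall of the programme: *Weil positivity at window `≍ log log γ₀`
excludes every off-line zero of maximal offset in its polylog window whose `(log γ₀)^{1/2}`-near
zone carries only a bounded, separated cluster of off-line zeros.*
-/

open MeasureTheory Complex Set Filter Topology Literature.NumberTheory.LFunctions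
open scoped ContDiff

namespace Summit.RiemannHypothesis.RiemannHypothesis.Theorems

variable {ψ : ℝ → ℝ}

/-- The maximal-offset cluster window offset `c₀(ψ, N, R₀, δ, η) =
max(η⁻¹ log(2Φ(−η)/Φ(η) + 1), (2η)⁻¹ log(4 (2K_N(ψ, R₀)/δ^{4N})/(η⁴ Φ(η)²) + 1))`. -/
noncomputable def clusterFarC0 (ψ : ℝ → ℝ) (N : ℕ) (R₀ δ η : ℝ) : ℝ :=
  max (Real.log (2 * bumpLaplace ψ (-η) / bumpLaplace ψ η + 1) / η)
    (Real.log (4 * (2 * clusterK ψ N R₀ / δ ^ (4 * N)) / (η ^ 4 * bumpLaplace ψ η ^ 2) + 1)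
      / (2 * η))

/-- **T29 (maximal-offset cluster visibility, window form).**  For `ψ ≥ 0` smooth on `[−1, 1]`
with `Φ(η) > 0`, `0 < η < ½`, `0 < δ ≤ 1`: if `|γ₀| ≥ 1`,
`c ≥ c₀(ψ, N, R₀, δ, η) + log log(|γ₀| + 2)/(2η)`, `R ≥ 1`, `e^{c+1} ≤ R²`, `e^{η(c+1)} ≤ Δ₀`,
`ζ(½ + η + iγ₀) = 0`, and every off-line zero of the window `|Im ρ − γ₀| < R` is one of the pair,
a member of the cluster `S'` (`|S'| ≤ N`, radius `≤ R₀`, distance `≥ δ` from the pair), or has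
offset `≤ η` at height distance `≥ Δ₀`, then `ε(c + 1) < 0`. -/
theorem weilGroundEnergy_neg_of_maxOffset_cluster_window_eff (hψ : ContDiff ℝ ∞ ψ)
    (hsupp : tsupport ψ ⊆ Icc (-1) 1) (hψ0 : ∀ s, 0 ≤ ψ s) {η : ℝ} (hη : 0 < η)
    (hη2 : η < 1 / 2) (hΦ : 0 < bumpLaplace ψ η) (N : ℕ) (R₀ : ℝ) {δ : ℝ} (hδ : 0 < δ)
    (hδ1 : δ ≤ 1) :
    ∀ (γ₀ c R Δ₀ : ℝ) (S' : Finset ℂ), 1 ≤ |γ₀| →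
      clusterFarC0 ψ N R₀ δ η + Real.log (Real.log (|γ₀| + 2)) / (2 * η) ≤ c → 1 ≤ R →
      Real.exp (c + 1) ≤ R ^ 2 → Real.exp (η * (c + 1)) ≤ Δ₀ →
      riemannZeta (1 / 2 + η + γ₀ * I) = 0 → S'.card ≤ N →
      (∀ ρ ∈ S', ‖ρ - (1 / 2 + γ₀ * I)‖ ≤ R₀ ∧ δ ≤ ‖ρ - (1 / 2 + η + γ₀ * I)‖ ∧
          δ ≤ ‖ρ - (1 / 2 - η + γ₀ * I)‖) →
      (∀ ρ : ℂ, riemannZeta ρ = 0 → 0 ≤ ρ.re → ρ.re ≤ 1 → |ρ.im - γ₀| < R → ρ.re ≠ 1 / 2 →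
          ρ = 1 / 2 + η + γ₀ * I ∨ ρ = 1 / 2 - η + γ₀ * I ∨ ρ ∈ S' ∨
            (|ρ.re - 1 / 2| ≤ η ∧ Δ₀ ≤ |ρ.im - γ₀|)) →
      weilGroundEnergy (c + 1) < 0 := by
  intro γ₀ c R Δ₀ S' hγ hc hR hRa hΔ hζ hcard hclus hloc
  unfold clusterFarC0 at hc
  have hδN : 0 < δ ^ (4 * N) := by positivity
  have hK := clusterK_pos ψ N R₀
  have hKδ : 0 < 2 * clusterK ψ N R₀ / δ ^ (4 * N) := by positivity
  obtain ⟨hc0, hdom, hwin⟩ :=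
    doubleLog_window_arith hKδ hΦ (bumpLaplace_nonneg hψ0 (-η)) hη hγ hc
  have hγ0 : γ₀ ≠ 0 := by intro h; rw [h, abs_zero] at hγ; linarith
  have hE1 : 1 ≤ Real.exp (η * (c + 1)) := Real.one_le_exp (by positivity)
  have hΔ1 : 1 ≤ Δ₀ := hE1.trans hΔ
  have hΔ0 : 0 < Δ₀ := by linarith
  have hX : Real.exp (η * (c + 1)) ^ 2 / Δ₀ ^ 2 ≤ 1 := by
    rw [div_le_one (by positivity)]
    exact pow_le_pow_left₀ (Real.exp_pos _).le hΔ 2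
  have hlog : 0 < Real.log (|γ₀| + 2) := Real.log_pos (by linarith [abs_nonneg γ₀])
  have hwin' : clusterK ψ N R₀ * (1 + Real.exp (η * (c + 1)) ^ 2 / Δ₀ ^ 2)
      * Real.log (|γ₀| + 2) <
      η ^ 4 * δ ^ (4 * N) *
        (Real.exp (η * c) * bumpLaplace ψ η - bumpLaplace ψ (-η)) ^ 2 := by
    have h := mul_lt_mul_of_pos_left hwin hδN
    have hδne : δ ^ (4 * N) ≠ 0 := hδN.ne'
    have e : δ ^ (4 * N) * (2 * clusterK ψ N R₀ / δ ^ (4 * N) * Real.log (|γ₀| + 2)) =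
        2 * clusterK ψ N R₀ * Real.log (|γ₀| + 2) := by
      field_simp
    rw [e] at h
    have hKL : 0 ≤ clusterK ψ N R₀ * Real.log (|γ₀| + 2) := by positivity
    calc clusterK ψ N R₀ * (1 + Real.exp (η * (c + 1)) ^ 2 / Δ₀ ^ 2) * Real.log (|γ₀| + 2)
        = (1 + Real.exp (η * (c + 1)) ^ 2 / Δ₀ ^ 2)
            * (clusterK ψ N R₀ * Real.log (|γ₀| + 2)) := by ring
      _ ≤ 2 * (clusterK ψ N R₀ * Real.log (|γ₀| + 2)) :=
          mul_le_mul_of_nonneg_right (by linarith) hKL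
      _ = 2 * clusterK ψ N R₀ * Real.log (|γ₀| + 2) := by ring
      _ < δ ^ (4 * N) * (η ^ 4 *
            (Real.exp (η * c) * bumpLaplace ψ η - bumpLaplace ψ (-η)) ^ 2) := h
      _ = η ^ 4 * δ ^ (4 * N) *
            (Real.exp (η * c) * bumpLaplace ψ η - bumpLaplace ψ (-η)) ^ 2 := by ring
  exact weilGroundEnergy_neg_of_maxOffset_cluster_eff hψ hsupp hψ0 N R₀ η γ₀ c R δ Δ₀ S' hη hη2
    hγ0 hc0 hR hRa hδ hδ1 hΔ1 hζ hcard hclus hloc hdom hwin'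

/-! ## T29′: the parameter-free form (`ψ₁ = windowPlateau 1`, either sign of `η`) -/

/-- **T29′ (maximal-offset cluster visibility, parameter-free).**  With `ψ₁ = windowPlateau 1`
and the definite offset `clusterFarC0 ψ₁ N R₀ δ |η|`, for either sign of `η ≠ 0`, `|η| < ½`:
`|γ₀| ≥ 1`, `c ≥ c₀ + log log(|γ₀| + 2)/(2|η|)`, `R ≥ 1`, `e^{c+1} ≤ R²`, `e^{|η|(c+1)} ≤ Δ₀`,
`ζ(½ + η + iγ₀) = 0`, the near cluster hypothesis and "no offset larger than `|η|` at height
distance `≥ Δ₀` in the window" ⟹ `ε(c + 1) < 0`. -/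
theorem weilGroundEnergy_neg_of_maxOffset_cluster_offset_eff {η : ℝ} (hη0 : η ≠ 0)
    (hη : |η| < 1 / 2) (N : ℕ) (R₀ : ℝ) {δ : ℝ} (hδ : 0 < δ) (hδ1 : δ ≤ 1) :
    ∀ (γ₀ c R Δ₀ : ℝ) (S' : Finset ℂ), 1 ≤ |γ₀| →
      clusterFarC0 (windowPlateau 1) N R₀ δ |η| + Real.log (Real.log (|γ₀| + 2)) / (2 * |η|)
        ≤ c →
      1 ≤ R → Real.exp (c + 1) ≤ R ^ 2 → Real.exp (|η| * (c + 1)) ≤ Δ₀ →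
      riemannZeta (1 / 2 + η + γ₀ * I) = 0 → S'.card ≤ N →
      (∀ ρ ∈ S', ‖ρ - (1 / 2 + γ₀ * I)‖ ≤ R₀ ∧ δ ≤ ‖ρ - (1 / 2 + η + γ₀ * I)‖ ∧
          δ ≤ ‖ρ - (1 / 2 - η + γ₀ * I)‖) →
      (∀ ρ : ℂ, riemannZeta ρ = 0 → 0 ≤ ρ.re → ρ.re ≤ 1 → |ρ.im - γ₀| < R → ρ.re ≠ 1 / 2 →
          ρ = 1 / 2 + η + γ₀ * I ∨ ρ = 1 / 2 - η + γ₀ * I ∨ ρ ∈ S' ∨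
            (|ρ.re - 1 / 2| ≤ |η| ∧ Δ₀ ≤ |ρ.im - γ₀|)) →
      weilGroundEnergy (c + 1) < 0 := by
  have hpos : 0 < |η| := abs_pos.mpr hη0
  have hT := weilGroundEnergy_neg_of_maxOffset_cluster_window_eff (ψ := windowPlateau 1)
    (contDiff_windowPlateau 1) (tsupport_windowPlateau_subset 1) (windowPlateau_nonneg 1) hpos hη
    (bumpLaplace_windowPlateau_one_pos |η|) N R₀ hδ hδ1
  intro γ₀ c R Δ₀ S' hγ hc hR hRa hΔ hζ hcard hclus hloc
  rcases le_or_gt 0 η with h | h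
  · have e : |η| = η := abs_of_nonneg h
    rw [e] at hT hc hΔ hloc
    exact hT γ₀ c R Δ₀ S' hγ hc hR hRa hΔ hζ hcard hclus hloc
  · have e : |η| = -η := abs_of_neg h
    rw [e] at hT hc hΔ hloc
    refine hT γ₀ c R Δ₀ S' hγ hc hR hRa hΔ ?_ hcard ?_ ?_
    · push_cast
      rw [show (1 / 2 + -(η : ℂ) + γ₀ * I) = 1 / 2 - η + γ₀ * I by ring]
      exact riemannZeta_zero_reflect hη hζ
    · intro ρ hρ
      obtain ⟨h1, h2, h3⟩ := hclus ρ hρ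
      push_cast
      refine ⟨h1, ?_, ?_⟩
      · rw [show (1 / 2 + -(η : ℂ) + γ₀ * I) = 1 / 2 - η + γ₀ * I by ring]; exact h3
      · rw [show (1 / 2 - -(η : ℂ) + γ₀ * I) = 1 / 2 + η + γ₀ * I by ring]; exact h2
    · intro ρ hz h0 h1 hnear hre
      push_cast
      rw [show (1 / 2 + -(η : ℂ) + γ₀ * I) = 1 / 2 - η + γ₀ * I by ring,
        show (1 / 2 - -(η : ℂ) + γ₀ * I) = 1 / 2 + η + γ₀ * I by ring]
      rcases hloc ρ hz h0 h1 hnear hre with h' | h' | h' | h'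
      · exact Or.inr (Or.inl h')
      · exact Or.inl h'
      · exact Or.inr (Or.inr (Or.inl h'))
      · exact Or.inr (Or.inr (Or.inr h'))

/-- **T29″ (exclusion form).**  Weil positivity at the window `c + 1`, the near cluster
hypothesis, and maximality of the offset `|η|` among the zeros of the window at height distance
`≥ Δ₀ ≥ e^{|η|(c+1)}` EXCLUDE the zero `½ + η + iγ₀`. -/
theorem riemannZeta_ne_zero_of_maxOffset_cluster_of_weilGroundEnergy_nonneg_eff {η : ℝ}
    (hη0 : η ≠ 0) (hη : |η| < 1 / 2) (N : ℕ) (R₀ : ℝ) {δ : ℝ} (hδ : 0 < δ) (hδ1 : δ ≤ 1) :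
    ∀ (γ₀ c R Δ₀ : ℝ) (S' : Finset ℂ), 1 ≤ |γ₀| →
      clusterFarC0 (windowPlateau 1) N R₀ δ |η| + Real.log (Real.log (|γ₀| + 2)) / (2 * |η|)
        ≤ c →
      1 ≤ R → Real.exp (c + 1) ≤ R ^ 2 → Real.exp (|η| * (c + 1)) ≤ Δ₀ → S'.card ≤ N →
      (∀ ρ ∈ S', ‖ρ - (1 / 2 + γ₀ * I)‖ ≤ R₀ ∧ δ ≤ ‖ρ - (1 / 2 + η + γ₀ * I)‖ ∧
          δ ≤ ‖ρ - (1 / 2 - η + γ₀ * I)‖) →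
      (∀ ρ : ℂ, riemannZeta ρ = 0 → 0 ≤ ρ.re → ρ.re ≤ 1 → |ρ.im - γ₀| < R → ρ.re ≠ 1 / 2 →
          ρ = 1 / 2 + η + γ₀ * I ∨ ρ = 1 / 2 - η + γ₀ * I ∨ ρ ∈ S' ∨
            (|ρ.re - 1 / 2| ≤ |η| ∧ Δ₀ ≤ |ρ.im - γ₀|)) →
      0 ≤ weilGroundEnergy (c + 1) →
      riemannZeta (1 / 2 + η + γ₀ * I) ≠ 0 := by
  intro γ₀ c R Δ₀ S' hγ hc hR hRa hΔ hcard hclus hloc hE hζ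
  have := weilGroundEnergy_neg_of_maxOffset_cluster_offset_eff hη0 hη N R₀ hδ hδ1 γ₀ c R Δ₀ S'
    hγ hc hR hRa hΔ hζ hcard hclus hloc
  linarith

/-- **The doubled cluster constant is a number** (conditional on Hasanalizade–Shen–Wong):
`2K_N(ψ, R₀) ≤ 864000 ((1 + R₀²)^N B_{2N+4}(ψ))² + 2`. -/
theorem two_mul_clusterK_le_of_hsw (h : zetaZeroCount_hasanalizade_shen_wong) (ψ : ℝ → ℝ)
    (N : ℕ) (R₀ : ℝ) :
    2 * clusterK ψ N R₀ ≤ 864000 * ((1 + R₀ ^ 2) ^ N * bumpNormSum ψ (2 * N + 4)) ^ 2 + 2 := by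
  have := clusterK_le_of_hsw h ψ N R₀
  linarith

end Summit.RiemannHypothesis.RiemannHypothesis.Theorems
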